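import Literature.AlgebraicGeometry.ModuliOfAbelianVarieties.SiegelUniversalFamilyPieceReadsFamily
import Literature.AlgebraicGeometry.ModuliOfAbelianVarieties.SiegelAdmissiblePackageAlongPullbacks
import Literature.AlgebraicGeometry.ModuliOfAbelianVarieties.SiegelModuliUniversalFamilyQuasiProjective
import Literature.AlgebraicGeometry.ShimuraVarieties.UnitaryCurveSliceMorphismPieceFactor
import Literature.AlgebraicGeometry.AbelianSchemes.AbelianSchemeEndomorphismTransportBaseChangeComp
import Literature.AlgebraicGeometry.AbelianSchemes.AbelianSchemeHomGlueOverCover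
import Literature.AlgebraicGeometry.AbelianSchemes.FibreReadingTransportAlongLeg
import Literature.AlgebraicGeometry.AbelianSchemes.AbelianSchemeTotalSpaceSmoothProjective
import Literature.AlgebraicGeometry.AbelianSchemes.AbelianSchemeTotalSpaceQuasiProjectiveBaseChange
import Literature.NumberTheory.Transcendental.AnalytificationExistenceProofs
import Mathlib.NumberTheory.NumberField.CMField
import HarnessLib

/-!
# Σ-AN OF THE E6 CLOSER: the glued endomorphisms of the pulled-back universal Siegel family over the thickened record curve READ the chart's
# lattice matrices through ONE admissible marking at every complex point — `ReadsCReading` from the (U3) junction, BY VALUE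
# ([Shimura1963AnalyticFamilies] §2; [BirkenhakeLange2004] Prop. 1.2.1; [Milne2005ShimuraVarieties] Thm. 6.11; [Lange2023AbelianVarietiesComplex] §3.4)

Cell `hodgecm-mathlib` (D-0151), FLOOR 0, P6 «MOD», crux hLiu418 = stmt-HodgeConjecture-24832 (`--supports`; HC_CM is proved only modulo the printed citations —
2 remaining named inputs hLiu418 24832, h413 24833 — until rung 0 closes; this file changes no count).  THEOREMS ONLY, BY VALUE (a Theorems file cannot import
the E-line `Cruxes/HLiu418/Lines/F0_P6a_PELWitnessE.lean`; every `AuxChartGS` field the proof reads is a binder, like ★ `F0P6aRosatiOverOfReading`).  This is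
the socket **Σ-AN** `hAN : ∀ ⟨stub_E6 binders⟩, Junction C → ∃ Y hY, ReadsCReading C ε Y hY` of the E6 closer skeleton v7 (A-p06 (g33), head
`stub_E6_of_junction_sigmaAN_sigmaGAL`); the closer closes `hAN` by `exact readsCReading_of_junction …` with the chart's fields (`iFi := τE.toAlgebra`).

THE ASSEMBLY (every step a ★ organ).  `X := (S.M Kc) ⊗_F Fᵢ`, `P := ε^*𝓜.univ`, `X_ℂ := X ⊗_{Fᵢ} ℂ`, `pr_X : X_ℂ → X`.
1. pieces of `X_ℂ`: `S.pieces Kc` along the tower iso (★ COV-1 `exists_towerIso_isColimit_cofan_of_comp_eq`); legs `h_q` form a coproduct cofan;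
2. per piece: ★ (T1) `exists_pieceSlice_factor_comp_eq` — `ψ_q : X_q ⟶ Sc_{c_q}` with the scheme equation `h_q ≫ pr_X ≫ ε ≫ pr = ψ_q ≫ ιc ≫ pr =: k_q`;
3. per piece: ★ PIECES family edition `exists_isMonHom_family_reads_of_piece` on `P_q := k_q^*𝓜.univ` (analytifications ★ `exists_isAnalytification_holds`,
   ★ E6-Π over ★ (F-c″) + ★ `isQuasiProjectiveOver_total_baseChange_of_tower`, `hK` = `Mρ_linear`, `htrans` = ★ COV-5 §4 + `pieces` (level) + `Z_equivariant`);
4. per `(q, b)`: the leg `(P.A ×_X X_ℂ) ×_{X_ℂ} X_q ≅ P_q.A` over `univ.A` (★ `IsBaseChangeVia.trans`, ★ `exists_isMonHom_iso_of_isBaseChangeVia`) and the conjugate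
   of `Y_q b` (★ `exists_isMonHom_conj_of_iso`); per `b`: ★ ASM (b) `exists_hom_of_isColimit_cofan` glues ⇒ `Y b ∈ End(P.A ×_X X_ℂ)`;
5. per complex point `x`: its point of `X_ℂ` lies in one piece (★ `Morphisms.exists_eq_of_isColimit_cofan`, `IsOpenImmersion.lift`); `pts x♭ = [v, g_q Kc]` (★ T1′);
   the (ADM)-package moves to `P` at `x` by ★ RD-T3 (`Q := 𝓜.univ`, keeping `γ = 1`, `Ψ = Π_{Z v}`), the reading by ★ RD-X (§0 `reading_transport_at_point`).
ELABORATION NOTES (why the proof looks the way it does): the organs are instantiated with the goal's OWN spelling of `X`, `φ₁`, `P`, `pr_X` (no local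
abbreviations; `[Algebra Fᵢ ℂ]` is a binder, not a `letI`), existentials are opened with `Exists.elim`, and the point-level bookkeeping is the variable-stated §0 lemma
— each of the alternatives exhausts the default heartbeat budget on this goal.  ED. 2 (heartbeat cure, proof-only, LA6-p02 (g2) on ops-buildfix custody N11): in step 4 the base equation `hk q` is transported by a small-typed local `congr_base` (`e ▸ h`) instead of `rw [hk q] at h'` (that one `rw` = 86k of the head's 204k heartbeats — keyed abstraction over the leg's scheme terms); head now 117k at the default budget; statements, imports and line count unchanged.

## References
* [Shimura1963AnalyticFamilies] G. Shimura, Ann. Math. 78 (1963), §2.  * [BirkenhakeLange2004] C. Birkenhake, H. Lange, *Complex Abelian Varieties* (2004), Prop. 1.2.1.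
* [Milne2005ShimuraVarieties] J. S. Milne, *Introduction to Shimura Varieties* (2005; rev. 2017), Thm. 6.11, Lemma 5.13.  * [Lange2023AbelianVarietiesComplex] H. Lange, *Abelian Varieties over the Complex Numbers* (2023), §3.4 Prop. 3.4.1, 3.4.7, 3.4.8.  * [Kottwitz1992] R. Kottwitz, J. AMS 5 (1992), §5.
-/

set_option autoImplicit false

noncomputable section

-- `Summit.HodgeConjecture.HodgeConjecture.…` repeats `HodgeConjecture` by design (D-0017); the lakefile turns `linter.dupNamespace`
-- off tree-wide (weak option), restated here so stand-alone elaboration is warning-free.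
set_option linter.dupNamespace false

namespace Summit.HodgeConjecture.HodgeConjecture.Theorems.F0P6aReadsCReadingOfJunction

open CategoryTheory CategoryTheory.Limits NumberField Matrix AlgebraicGeometry Topology
open scoped Matrix ComplexOrder Manifold ContDiff
open Literature.AlgebraicGeometry.Motives (SchemeOver AlgPoints ComplexPoints specOver IsSmoothProjective)
open Literature.AlgebraicGeometry.Motives.AbelianVariety (bcSpec)
open Literature.AlgebraicGeometry.AbelianSchemes (PolarizedAbelianSchemeWithLevel AbelianSchemeOver)
open Literature.AlgebraicGeometry.AbelianSchemes.AbelianSchemeOver (fibreHom)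
open Literature.AlgebraicGeometry.ModuliOfAbelianVarieties
open Literature.AlgebraicGeometry.ShimuraVarieties Literature.AlgebraicGeometry.ShimuraVarieties.UnitaryCanonicalModel
open Literature.AlgebraicGeometry.HodgeTheory (IsQuasiProjectiveOver)
open Literature.NumberTheory.Automorphic Literature.NumberTheory.Automorphic.UnitaryGroup
open Literature.Geometry.Kaehler (ComplexTorus)
open Literature.NumberTheory.Automorphic.Liu2021.AppendixC (C5.OpenCompactSubgroup C5.SmallLevel)
open Literature.Geometry.ComplexAnalytic (totalOver)
open Literature.NumberTheory.Transcendental (IsAnalytification exists_isAnalytification_holds)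

/-! ### §0 Two bridges -/

/-- A fibre isomorphism over `G` in SCHEME form (★ RD-T3's output) is over `G` on POINTS (★ RD-X's input). [cite: GortzWedhorn2020, Section (4.7), (4.7.1) (p. 108)] -/
theorem fibrePointToLeft_map_eq_of_toSchemeHom_comp {M S : Scheme.{0}} (Q : AbelianSchemeOver M) (A : AbelianSchemeOver S) (G : A.X.left ⟶ Q.X.left)
    {s : Spec (.of ℂ) ⟶ S} {p : Spec (.of ℂ) ⟶ M} (e : (A.fibre s).toAbelianVariety ≅ (Q.fibre p).toAbelianVariety)
    (he : Literature.AlgebraicGeometry.Motives.AbelianVariety.Hom.toSchemeHom e.hom ≫ pullback.fst Q.X.hom p = pullback.fst A.X.hom s ≫ G)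
    (P : (A.fibre s).toAbelianVariety.Points ℂ) :
    Q.fibrePointToLeft p (AlgPoints.map e.hom.hom.hom.hom P) = A.fibrePointToLeft s P ≫ G :=
  ((Category.assoc _ _ _).trans (congrArg (fun φ => P.left ≫ φ) he)).trans (Category.assoc _ _ _).symm

/-- `Spec ℂ` has one point: a morphism from it lands in the range of any morphism hitting its image point. [folklore] [cite: GortzWedhorn2020, §(3.5) Example 3.11 (p. 73)] -/
theorem range_subset_range_of_eq {X Y : Scheme.{0}} (x : Spec (.of ℂ) ⟶ X) (h : Y ⟶ X) (y : Y) (z : ↥(Spec (.of ℂ)))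
    (hy : h.base y = x.base z) : Set.range x.base ⊆ Set.range h.base := by
  haveI : Subsingleton ↥(Spec (CommRingCat.of ℂ)) := inferInstanceAs (Subsingleton (PrimeSpectrum ℂ))
  rintro _ ⟨z', rfl⟩
  exact ⟨y, by rw [hy, Subsingleton.elim z' z]⟩

/-- A complex point is a section of the structure morphism to `Spec ℂ`. [folklore] [cite: GortzWedhorn2020, Section (4.7) p. 108] -/
theorem specOver_complex_hom : (specOver ℂ ℂ).hom = 𝟙 (Spec (.of ℂ)) := by
  change Spec.map (CommRingCat.ofHom (RingHom.id ℂ)) = _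
  rw [CommRingCat.ofHom_id]
  exact Spec.map_id _

/-- **The reading equation at a point of `X_ℂ = X ×_B C`, transported along a leg** — ★ RD-X `fibre_reading_transport_along_leg` with its premiss
`q ≫ pr₂ = t₀ ≫ ι` derived from the SECTION form `q ≫ pr₂ ≫ pr₂ = c₀` (the shape of the closer's `ReadsCReading` clause: the point of `X_ℂ` under `q` is
pinned by its two projections, ★ `pullback.hom_ext`), and the two fibre points rewritten through given equations (`hR`, `hR'`: the transported
marking `toFun₂ = e₂⁻¹ ∘ e₁ ∘ toFun₁` of ★ RD-T3).  Stated over variables so that the assembly below instantiates it by unification only.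
[cite: GortzWedhorn2020, Section (4.7), (4.7.1) (p. 108)] [cite: MumfordFogartyKirwan1994, Ch. 6 §2 Definition 6.3 (p. 120)] -/
theorem reading_transport_at_point {M X T C B : Scheme.{0}} (Q : AbelianSchemeOver M) (A₂ : AbelianSchemeOver X) (A₁ : AbelianSchemeOver T)
    (G₂ : A₂.X.left ⟶ Q.X.left) (G₁ : A₁.X.left ⟶ Q.X.left) (f : X ⟶ B) (g : C ⟶ B) (ι : T ⟶ pullback f g)
    (eT : ((A₂.baseChange (pullback.fst f g)).baseChange ι).X ≅ A₁.X) [hmT : IsMonHom eT.hom]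
    (heT : eT.hom.left ≫ G₁ =
      pullback.fst (pullback.snd A₂.X.hom (pullback.fst f g)) ι ≫ pullback.fst A₂.X.hom (pullback.fst f g) ≫ G₂)
    (Y : (A₂.baseChange (pullback.fst f g)).X ⟶ (A₂.baseChange (pullback.fst f g)).X) [hmY : IsMonHom Y]
    (Y₁ : A₁.X ⟶ A₁.X) [hmY₁ : IsMonHom Y₁] (hY : (Over.pullback ι).map Y ≫ eT.hom = eT.hom ≫ Y₁)
    {t₀ : Spec (.of ℂ) ⟶ T} {x : Spec (.of ℂ) ⟶ X} {p : Spec (.of ℂ) ⟶ M} (xc : Spec (.of ℂ) ⟶ pullback f g) (c₀ : Spec (.of ℂ) ⟶ C)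
    (hxc : xc ≫ pullback.fst f g = x) (hxc₂ : xc ≫ pullback.snd f g = c₀) (ht₀ : t₀ ≫ ι = xc)
    (e₁ : (A₁.fibre t₀).toAbelianVariety ≅ (Q.fibre p).toAbelianVariety)
    (he₁ : ∀ P, Q.fibrePointToLeft p (AlgPoints.map e₁.hom.hom.hom.hom P) = A₁.fibrePointToLeft t₀ P ≫ G₁)
    (e₂ : (A₂.fibre x).toAbelianVariety ≅ (Q.fibre p).toAbelianVariety)
    (he₂ : ∀ P, Q.fibrePointToLeft p (AlgPoints.map e₂.hom.hom.hom.hom P) = A₂.fibrePointToLeft x P ≫ G₂)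
    {P₁ P₁' : (A₁.fibre t₀).toAbelianVariety.Points ℂ} (hread : AlgPoints.map (fibreHom Y₁ t₀).hom.hom.hom P₁ = P₁')
    {R R' : (A₂.fibre x).toAbelianVariety.Points ℂ}
    (hR : R = AlgPoints.map e₂.inv.hom.hom.hom (AlgPoints.map e₁.hom.hom.hom.hom P₁))
    (hR' : R' = AlgPoints.map e₂.inv.hom.hom.hom (AlgPoints.map e₁.hom.hom.hom.hom P₁'))
    (q : Spec (.of ℂ) ⟶ pullback A₂.X.hom (pullback.fst f g))
    (hq₁ : q ≫ pullback.fst A₂.X.hom (pullback.fst f g) = A₂.fibrePointToLeft x R)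
    (hq₂ : q ≫ pullback.snd A₂.X.hom (pullback.fst f g) ≫ pullback.snd f g = c₀) :
    (q ≫ Y.left) ≫ pullback.fst A₂.X.hom (pullback.fst f g) = A₂.fibrePointToLeft x R' := by
  subst hR hR'
  have hx : t₀ ≫ ι ≫ pullback.fst f g = x := by rw [← Category.assoc, ht₀, hxc]
  have hq₂' : q ≫ pullback.snd A₂.X.hom (pullback.fst f g) = t₀ ≫ ι := by
    rw [ht₀]
    apply pullback.hom_ext
    · rw [Category.assoc, ← pullback.condition, ← Category.assoc, hq₁, A₂.fibrePointToLeft_comp_hom, hxc]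
    · rw [Category.assoc, hq₂, hxc₂]
  exact AbelianSchemeOver.fibre_reading_transport_along_leg Q A₂ A₁ G₂ G₁ (pullback.fst f g) ι eT heT Y Y₁ hY hx e₁ he₁ e₂ he₂
    hread q hq₁ hq₂'

/-! ### §1 THE HEAD -/

/-- **Σ-AN — THE GLUED ENDOMORPHISMS READ THE CHART'S LATTICE MATRICES THROUGH ONE ADMISSIBLE MARKING AT EVERY COMPLEX POINT** (`∃ Y hY, ReadsCReading C ε Y hY`
of the E6 closer, BY VALUE; hypotheses = the `AuxChartGS` fields the proof reads + the (U3) `junction` + `ε`, `hε`, ★ P-3 `hU`).  See the module docstring for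
the five-step assembly. [cite: Shimura1963AnalyticFamilies, §2] [cite: BirkenhakeLange2004, §1.2 Proposition 1.2.1] [cite: Milne2005ShimuraVarieties, §6 Thm. 6.11 pp. 74–75]
[cite: Lange2023AbelianVarietiesComplex, §3.4 Proposition 3.4.1] [cite: Kottwitz1992, §5 (p. 390)] -/
theorem readsCReading_of_junction
    {F : Type} [Field F] [NumberField F] [IsCMField F] {ι₁ : F →+* ℂ} {Jstar : Matrix (Fin 2) (Fin 2) F}
    {K₀ : C5.OpenCompactSubgroup ↥(finAdelic (↥(maximalRealSubfield F)) F (IsCMField.complexConj F) 2 Jstar)}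
    (S : RecordSystemGS F Jstar ι₁ K₀) (Kc : C5.SmallLevel K₀)
    {Fi : Type} [Field Fi] [NumberField Fi] [Algebra F Fi] [iFi : Algebra Fi ℂ] (hτE : (algebraMap Fi ℂ).comp (algebraMap F Fi) = ι₁)
    -- the Siegel side of the chart, by value
    {g N : ℕ} {δ : Fin g → ℕ} (hg : 0 < g) (hδ : IsPolarizationType δ) (hN : 3 ≤ N) (𝓜 : SiegelFineModuliScheme g N δ)
    [Smooth 𝓜.M.hom] (quasiProjective_M : IsQuasiProjectiveOver 𝓜.M)
    (Sc : (ZMod N)ˣ → SchemeOver ℂ) (ιc : ∀ c, Sc c ⟶ (Literature.AlgebraicGeometry.Motives.baseChange ℚ ℂ).obj 𝓜.M)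
    (hcol : IsColimit (Cofan.mk ((Literature.AlgebraicGeometry.Motives.baseChange ℚ ℂ).obj 𝓜.M) ιc))
    (unif : ∀ c : (ZMod N)ˣ, Matrix (Fin g) (Fin g) ℂ → ComplexPoints (Sc c))
    (unif_cont : ∀ c, ContinuousOn (unif c) (siegelUpperHalfSpace g))
    (unif_open : ∀ c, IsOpenMap ((siegelUpperHalfSpace g).restrict (unif c)))
    (unif_surj : ∀ c, Set.SurjOn (unif c) (siegelUpperHalfSpace g) Set.univ)
    (unif_iff : ∀ c, ∀ W ∈ siegelUpperHalfSpace g, ∀ W' ∈ siegelUpperHalfSpace g,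
      unif c W = unif c W' ↔ ∃ M ∈ siegelLevelGroup δ N, ∃ C : (Fin g → ℂ) ≃ₗ[ℂ] (Fin g → ℂ),
        ∀ x : Fin g ⊕ Fin g → ℝ, C (siegelPeriodMap δ W x) = siegelPeriodMap δ W' (intAct M x))
    (unif_hol : ∀ (c : (ZMod N)ˣ) (U : (Sc c).left.affineOpens) (s : (Sc c).left.presheaf.obj (Opposite.op (↑U : (Sc c).left.Opens))),
      DifferentiableOn ℂ (fun Z ↦ AlgPoints.evalOrZero (↑U : (Sc c).left.Opens) s (unif c Z))
        (siegelUpperHalfSpace g ∩ unif c ⁻¹' {P | P.pt ∈ (↑U : (Sc c).left.Opens)}))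
    -- the chart's point data, by value
    (f : ShimuraSetGS F Jstar ι₁ Kc.1.1 → ComplexPoints 𝓜.M)
    (piece : ↥(finAdelic (↥(maximalRealSubfield F)) F (IsCMField.complexConj F) 2 Jstar) → (ZMod N)ˣ)
    (Z : ↥(finAdelic (↥(maximalRealSubfield F)) F (IsCMField.complexConj F) 2 Jstar) → (Fin 2 → ℂ) → Matrix (Fin g) (Fin g) ℂ)
    (u : (ZMod N)ˣ → finAdeleQˣ) (rep : (ZMod N)ˣ → ↥(gspFinAdelic δ))
    (rep_spec : ∀ c, (∀ w, Valued.v ((u c : finAdeleQ) w) = 1) ∧ (u c : finAdeleQ) - ((c : ZMod N).val : ℕ) ∈ levelIdeal N ∧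
      rep c ∈ principalLevelSubgroup δ 1 ∧
        IsMultiplier (typeFormOver δ finAdeleQ) (rep c : GL (Fin g ⊕ Fin g) finAdeleQ) (u c) ∧
          ((rep c : GL (Fin g ⊕ Fin g) finAdeleQ) : Matrix (Fin g ⊕ Fin g) (Fin g ⊕ Fin g) finAdeleQ) =
            Matrix.fromBlocks 1 0 0 ((u c : finAdeleQ) • (1 : Matrix (Fin g) (Fin g) finAdeleQ)))
    (Z_hol : ∀ (a : ↥(finAdelic (↥(maximalRealSubfield F)) F (IsCMField.complexConj F) 2 Jstar)) (i j : Fin g),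
      DifferentiableOn ℂ (fun v => Z a v i j) (negCone (Jstar.map ι₁)))
    (Z_mem : ∀ (a : ↥(finAdelic (↥(maximalRealSubfield F)) F (IsCMField.complexConj F) 2 Jstar)) (v : Fin 2 → ℂ),
      v ∈ negCone (Jstar.map ι₁) → Z a v ∈ siegelUpperHalfSpace g)
    (f_mk : ∀ (v : Fin 2 → ℂ) (hv : v ∈ negCone (Jstar.map ι₁)) (a : ↥(finAdelic (↥(maximalRealSubfield F)) F (IsCMField.complexConj F) 2 Jstar)),
      f (ShimuraSetGS.mk F Jstar ι₁ Kc.1.1 v hv a) =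
        (AlgPoints.baseChangeEquiv (algebraMap ℚ ℂ) 𝓜.M).symm (AlgPoints.map (ιc (piece a)) (unif (piece a) (Z a v))))
    -- the lattice reading, period-linear, and the period equivariance (M-eq)
    (Mρ : ↥(finAdelic (↥(maximalRealSubfield F)) F (IsCMField.complexConj F) 2 Jstar) → (𝓞 F →+* Matrix (Fin g ⊕ Fin g) (Fin g ⊕ Fin g) ℤ))
    (Mρ_linear : ∀ (a : ↥(finAdelic (↥(maximalRealSubfield F)) F (IsCMField.complexConj F) 2 Jstar)) (v : Fin 2 → ℂ), v ∈ negCone (Jstar.map ι₁) →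
      ∀ b : 𝓞 F, ∃ Cb : (Fin g → ℂ) →ₗ[ℂ] (Fin g → ℂ),
        ∀ w : Fin g ⊕ Fin g → ℝ, Cb (siegelPeriodMap δ (Z a v) w) = siegelPeriodMap δ (Z a v) (((Mρ a b).map (Int.cast : ℤ → ℝ)) *ᵥ w))
    (Z_equivariant : ∀ (a : ↥(finAdelic (↥(maximalRealSubfield F)) F (IsCMField.complexConj F) 2 Jstar)) (γ : GL (Fin 2) F),
      γ ∈ arithmeticLevel (↥(maximalRealSubfield F)) F (IsCMField.complexConj F) 2 Jstar (Kc.1.1.map (MulAut.conj a).toMonoidHom) →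
      ∀ (v : Fin 2 → ℂ), v ∈ negCone (Jstar.map ι₁) → ∀ (v' : Fin 2 → ℂ), v' ∈ negCone (Jstar.map ι₁) →
      ∀ c : ℂ, c ≠ 0 → ((γ : Matrix (Fin 2) (Fin 2) F).map ι₁) *ᵥ v = c • v' →
      ∃ M ∈ siegelLevelGroup δ N, ∃ L : (Fin g → ℂ) ≃ₗ[ℂ] (Fin g → ℂ),
        (∀ w : Fin g ⊕ Fin g → ℝ, L (siegelPeriodMap δ (Z a v) w) = siegelPeriodMap δ (Z a v') (intAct M w)) ∧
        ∀ b : 𝓞 F, (M : Matrix (Fin g ⊕ Fin g) (Fin g ⊕ Fin g) ℤ) * Mρ a b = Mρ a b * M)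
    -- the (U3) JUNCTION of the chart's pieces at every `Z` (the E-line ED. 5 field `junction`, by value)
    (junction : ∀ (c : (ZMod N)ˣ) (u : finAdeleQˣ) (r : gspFinAdelic δ),
      (∀ v, Valued.v ((u : finAdeleQ) v) = 1) → (u : finAdeleQ) - ((c : ZMod N).val : ℕ) ∈ levelIdeal N →
      r ∈ principalLevelSubgroup δ 1 → IsMultiplier (typeFormOver δ finAdeleQ) (r : GL (Fin g ⊕ Fin g) finAdeleQ) u →
      ((r : GL (Fin g ⊕ Fin g) finAdeleQ) : Matrix (Fin g ⊕ Fin g) (Fin g ⊕ Fin g) finAdeleQ) =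
        Matrix.fromBlocks 1 0 0 ((u : finAdeleQ) • (1 : Matrix (Fin g) (Fin g) finAdeleQ)) →
      ∀ (W : Matrix (Fin g) (Fin g) ℂ) (hW : W ∈ siegelUpperHalfSpace g),
        haveI : IsLocallyNoetherian (specOver ℚ ℂ).left :=
          inferInstanceAs (IsLocallyNoetherian (Spec (CommRingCat.of ℂ)))
        (∃ (P' : PolarizedAbelianSchemeWithLevel g N δ (specOver ℚ ℂ).left)
            (G : P'.A.X.left ⟶ 𝓜.univ.A.X.left) (Ĝ : P'.D.hat.X.left ⟶ 𝓜.univ.D.hat.X.left),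
            P'.IsBaseChangeVia 𝓜.univ
                ((AlgPoints.baseChangeEquiv (algebraMap ℚ ℂ) 𝓜.M).symm (AlgPoints.map (ιc c) (unif c W))).left G Ĝ ∧
            IsAdmissibleAt hδ r W hW P') ∧
        (∀ (P' : PolarizedAbelianSchemeWithLevel g N δ (specOver ℚ ℂ).left), IsAdmissibleAt hδ r W hW P' →
            AlgPoints.map (ιc c) (unif c W)
              = AlgPoints.baseChangeEquiv (algebraMap ℚ ℂ) 𝓜.M (𝓜.classifyingMap (specOver ℚ ℂ) P')))
    -- the descended slice morphism with its point formula (`stub_E6`'s `ε`, `hε`) and ★ P-3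
    (ε : (Literature.AlgebraicGeometry.Motives.baseChange F Fi).obj (S.M.obj Kc) ⟶
        (Literature.AlgebraicGeometry.Motives.baseChange ℚ Fi).obj 𝓜.M)
    (hε : ∀ (P : ComplexPoints ((Literature.AlgebraicGeometry.Motives.baseChange F Fi).obj (S.M.obj Kc)))
        (Pflat : letI : Algebra F ℂ := ι₁.toAlgebra; ComplexPoints (S.M.obj Kc)),
        Pflat.left = P.left ≫ pullback.fst (S.M.obj Kc).hom (bcSpec F Fi) →
        (AlgPoints.map ε P).left ≫ pullback.fst 𝓜.M.hom (bcSpec ℚ Fi) =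
          (letI : Algebra F ℂ := ι₁.toAlgebra; (f (S.pts Kc Pflat)).left))
    (hU : siegelUniversalFamilyUniformisation) :
    ∃ (Y : 𝓞 F → (((𝓜.univ.baseChange (ε.left ≫ pullback.fst 𝓜.M.hom (bcSpec ℚ Fi))).A.baseChange
        (pullback.fst ((Literature.AlgebraicGeometry.Motives.baseChange F Fi).obj (S.M.obj Kc)).hom (bcSpec Fi ℂ))).X ⟶
        ((𝓜.univ.baseChange (ε.left ≫ pullback.fst 𝓜.M.hom (bcSpec ℚ Fi))).A.baseChange
        (pullback.fst ((Literature.AlgebraicGeometry.Motives.baseChange F Fi).obj (S.M.obj Kc)).hom (bcSpec Fi ℂ))).X))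
      (_hY : ∀ b, IsMonHom (Y b)),
    letI P := 𝓜.univ.baseChange (ε.left ≫ pullback.fst 𝓜.M.hom (bcSpec ℚ Fi))
    letI X := (Literature.AlgebraicGeometry.Motives.baseChange F Fi).obj (S.M.obj Kc)
    letI prX := pullback.fst X.hom (bcSpec Fi ℂ)
    ∀ (x : ComplexPoints X) (Pflat : letI : Algebra F ℂ := ι₁.toAlgebra; ComplexPoints (S.M.obj Kc)),
      Pflat.left = x.left ≫ pullback.fst (S.M.obj Kc).hom (bcSpec F Fi) →
      ∃ (v : Fin 2 → ℂ) (hv : v ∈ negCone (Jstar.map ι₁)) (a : ↥(finAdelic (↥(maximalRealSubfield F)) F (IsCMField.complexConj F) 2 Jstar)),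
        (letI : Algebra F ℂ := ι₁.toAlgebra; S.pts Kc Pflat) = ShimuraSetGS.mk F Jstar ι₁ Kc.1.1 v hv a ∧
        ∀ (u : finAdeleQˣ) (r : gspFinAdelic δ),
          (∀ w, Valued.v ((u : finAdeleQ) w) = 1) → (u : finAdeleQ) - ((piece a : ZMod N).val : ℕ) ∈ levelIdeal N →
          r ∈ principalLevelSubgroup δ 1 → IsMultiplier (typeFormOver δ finAdeleQ) (r : GL (Fin g ⊕ Fin g) finAdeleQ) u →
          ((r : GL (Fin g ⊕ Fin g) finAdeleQ) : Matrix (Fin g ⊕ Fin g) (Fin g ⊕ Fin g) finAdeleQ) =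
            Matrix.fromBlocks 1 0 0 ((u : finAdeleQ) • (1 : Matrix (Fin g) (Fin g) finAdeleQ)) →
          ∃ (m : SiegelAdelicMarking ⟨SiegelModuli.jOfSiegel δ (Z a v),
                SiegelComplexRecordSystem.jOfSiegel_mem_C0pm hδ.1 (Z_mem a v hv)⟩ r (P.A.fibre x.left).toAbelianVariety)
            (Θ : Literature.AlgebraicGeometry.Motives.CartierDivisor (P.A.fibre x.left).toAbelianVariety.X.left)
            (Λ : P.level.SymplecticLift x.left Θ δ),
            Θ.IsAmple ∧ P.A.IsLambdaOfAt x.left P.D P.pol.lam Θ ∧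
            (∀ ⦃M : ℕ⦄, N ∣ M → M ≠ 0 → ∀ (y : Fin g ⊕ Fin g → ZMod M) (w : Fin g ⊕ Fin g → ℚ),
              AdelicCongr ((r⁻¹ : gspFinAdelic δ) : GL (Fin g ⊕ Fin g) finAdeleQ) 1 w (fun i => ((y i).val : ℚ) / M) →
                ((Λ.lift M (Multiplicative.ofAdd y)) : (P.A.fibre x.left).toAbelianVariety.Points ℂ) = m.r w) ∧
            m.γ = 1 ∧ (∀ w : Fin g ⊕ Fin g → ℝ, m.Ψ w = siegelPeriodMap δ (Z a v) w) ∧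
            ∀ (b : 𝓞 F) (t : ComplexTorus m.Ψ) (q : Spec (.of ℂ) ⟶ pullback P.A.X.hom prX),
              q ≫ pullback.fst P.A.X.hom prX = P.A.fibrePointToLeft x.left (m.toFun t) →
              q ≫ pullback.snd P.A.X.hom prX ≫ pullback.snd X.hom (bcSpec Fi ℂ) = 𝟙 _ →
              (q ≫ (Y b).left) ≫ pullback.fst P.A.X.hom prX =
                P.A.fibrePointToLeft x.left (m.toFun (ComplexTorus.mapMatrix m.Ψ m.Ψ (Mρ a b) t)) := by
  haveI : IsSeparated 𝓜.M.hom := IsQuasiProjectiveOver.hom_isSeparated quasiProjective_M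
  -- §1 the pieces of `(S.M Kc) ⊗_{ι₁} ℂ`, moved to `X_ℂ` along the tower (★ COV-1)
  refine (S.pieces Kc).elim fun gq h1 => h1.elim fun hgq h2 => h2.elim fun Xp h3 => h3.elim fun leg h4 => h4.elim fun hcolS h5 =>
    h5.elim fun B hB => ?_
  refine (Literature.AlgebraicGeometry.Motives.exists_towerIso_isColimit_cofan_of_comp_eq (algebraMap Fi ℂ) ι₁ hτE (S.M.obj Kc) Xp leg hcolS).elim
    fun e he => he.2.1 |> fun he₂ => he.2.2.2.elim fun hcolL₀ => ?_
  let hq : ∀ q, (Xp q).left ⟶ (pullback ((Literature.AlgebraicGeometry.Motives.baseChange F Fi).obj (S.M.obj Kc)).hom (bcSpec Fi ℂ)) := fun q => (leg q ≫ e.inv).left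
  have hcolL : IsColimit (Cofan.mk (pullback ((Literature.AlgebraicGeometry.Motives.baseChange F Fi).obj (S.M.obj Kc)).hom (bcSpec Fi ℂ)) hq) := hcolL₀
  haveI hopen : ∀ q, IsOpenImmersion (hq q) := fun q =>
    Literature.AlgebraicGeometry.Morphisms.isOpenImmersion_of_isColimit_cofan hcolL q
  -- §2 per piece: the slice factor `ψ q` and the scheme equation `hk q` (★ T1)
  have hT1 : ∀ q, ∃ ψq : Xp q ⟶ Sc (piece (gq q)),
      (∀ v, v ∈ negCone (Jstar.map ι₁) → AlgPoints.map ψq ((B q).unif v) = unif (piece (gq q)) (Z (gq q) v)) ∧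
      hq q ≫ (pullback.fst ((Literature.AlgebraicGeometry.Motives.baseChange F Fi).obj (S.M.obj Kc)).hom (bcSpec Fi ℂ)) ≫ (ε.left ≫ pullback.fst 𝓜.M.hom (bcSpec ℚ Fi)) =
        ψq.left ≫ (ιc (piece (gq q))).left ≫ pullback.fst 𝓜.M.hom (Spec.map (CommRingCat.ofHom (algebraMap ℚ ℂ))) := fun q =>
    exists_pieceSlice_factor_comp_eq S Kc (algebraMap Fi ℂ) 𝓜.M quasiProjective_M Sc ιc hcol unif unif_cont unif_hol f piece Z Z_hol Z_mem
      f_mk ε hε e he₂ (Xp q) (B q) (hB q).1 (leg q) (gq q) (hB q).2.2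
  choose ψ hψ hk using hT1
  let kq : ∀ q, (Xp q).left ⟶ 𝓜.M.left := fun q =>
    (ψ q).left ≫ (ιc (piece (gq q))).left ≫ pullback.fst 𝓜.M.hom (Spec.map (CommRingCat.ofHom (algebraMap ℚ ℂ)))
  let Pq : ∀ q, PolarizedAbelianSchemeWithLevel g N δ (Xp q).left := fun q => 𝓜.univ.baseChange (kq q)
  -- §3 per piece: ★ PIECES (family edition), read at the complex points of the piece
  have hpiece : ∀ q, ∃ (Yq : 𝓞 F → ((𝓜.univ.A.baseChange (kq q)).X ⟶ (𝓜.univ.A.baseChange (kq q)).X)) (hYq : ∀ b, IsMonHom (Yq b)),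
      ∀ T₀ : ComplexPoints (Xp q), ∃ v : Fin 2 → ℂ, v ∈ negCone (Jstar.map ι₁) ∧ (B q).unif v = T₀ ∧
        ∀ (u' : finAdeleQˣ) (r' : gspFinAdelic δ),
          (∀ w, Valued.v ((u' : finAdeleQ) w) = 1) → (u' : finAdeleQ) - ((piece (gq q) : ZMod N).val : ℕ) ∈ levelIdeal N →
          r' ∈ principalLevelSubgroup δ 1 → IsMultiplier (typeFormOver δ finAdeleQ) (r' : GL (Fin g ⊕ Fin g) finAdeleQ) u' →
          ((r' : GL (Fin g ⊕ Fin g) finAdeleQ) : Matrix (Fin g ⊕ Fin g) (Fin g ⊕ Fin g) finAdeleQ) =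
            Matrix.fromBlocks 1 0 0 ((u' : finAdeleQ) • (1 : Matrix (Fin g) (Fin g) finAdeleQ)) →
          ∃ (hZv : Z (gq q) v ∈ siegelUpperHalfSpace g)
            (m : SiegelAdelicMarking ⟨SiegelModuli.jOfSiegel δ (Z (gq q) v), SiegelComplexRecordSystem.jOfSiegel_mem_C0pm hδ.1 hZv⟩ r'
              ((Pq q).A.fibre T₀.left).toAbelianVariety)
            (Θ : Literature.AlgebraicGeometry.Motives.CartierDivisor ((Pq q).A.fibre T₀.left).toAbelianVariety.X.left)
            (Λ : (Pq q).level.SymplecticLift T₀.left Θ δ),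
            Θ.IsAmple ∧ (Pq q).A.IsLambdaOfAt T₀.left (Pq q).D (Pq q).pol.lam Θ ∧
            (∀ ⦃M : ℕ⦄, N ∣ M → M ≠ 0 → ∀ (y : Fin g ⊕ Fin g → ZMod M) (w : Fin g ⊕ Fin g → ℚ),
              AdelicCongr ((r'⁻¹ : gspFinAdelic δ) : GL (Fin g ⊕ Fin g) finAdeleQ) 1 w (fun i => ((y i).val : ℚ) / M) →
                ((Λ.lift M (Multiplicative.ofAdd y)) : ((Pq q).A.fibre T₀.left).toAbelianVariety.Points ℂ) = m.r w) ∧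
            m.γ = 1 ∧ (∀ w : Fin g ⊕ Fin g → ℝ, m.Ψ w = siegelPeriodMap δ (Z (gq q) v) w) ∧
            ∀ (b : 𝓞 F) (τ : ComplexTorus m.Ψ),
              haveI := hYq b
              AlgPoints.map (fibreHom (Yq b) T₀.left).hom.hom.hom (m.toFun τ) = m.toFun (ComplexTorus.mapMatrix m.Ψ m.Ψ (Mρ (gq q) b) τ) := by
    intro q
    have hXq : IsSmoothProjective 1 (Xp q) := (B q).isSmoothProjective
    haveI : SmoothOfRelativeDimension 1 (Xp q).hom := hXq.smoothOfRelativeDimension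
    haveI : IsProper (Xp q).hom := IsSmoothProjective.isProper_holds hXq
    haveI : IsSeparated (Xp q).hom := inferInstance; haveI : LocallyOfFiniteType (Xp q).hom := inferInstance
    obtain ⟨MT, _, _, _, _, φT, hT⟩ := exists_isAnalytification_holds (Xp q) 1
    -- ★ E6-Π: the total space of `P_q.A` is smooth projective of dimension `1 + g` (over ★ (F-c″) and the tower lemma)
    have hqpU := 𝓜.isQuasiProjectiveOver_univ hδ quasiProjective_M
    have hXqp : IsQuasiProjectiveOver (Xp q) :=
      Literature.AlgebraicGeometry.HodgeTheory.IsQuasiProjectiveOver.of_isProjectiveOver hXq.isProjectiveOver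
    have hqpT := 𝓜.univ.A.isQuasiProjectiveOver_total_baseChange_of_tower (K := ℂ) hqpU (ψ q ≫ ιc (piece (gq q))) hXqp
    have hkq : (ψ q ≫ ιc (piece (gq q))).left ≫ pullback.fst 𝓜.M.hom (bcSpec ℚ ℂ) = kq q := Category.assoc _ _ _
    rw [hkq] at hqpT
    have hTot : IsSmoothProjective (1 + g) (totalOver (Xp q) (Pq q).A) :=
      AbelianSchemeOver.isSmoothProjective_total (A := (Pq q).A) hXq (Pq q).relDim hqpT
    haveI : SmoothOfRelativeDimension (1 + g) (totalOver (Xp q) (Pq q).A).hom := hTot.smoothOfRelativeDimension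
    haveI : IsProper (totalOver (Xp q) (Pq q).A).hom := IsSmoothProjective.isProper_holds hTot
    haveI : IsSeparated (totalOver (Xp q) (Pq q).A).hom := inferInstance; haveI : LocallyOfFiniteType (totalOver (Xp q) (Pq q).A).hom := inferInstance
    obtain ⟨MA, _, _, _, _, φA, hA⟩ := exists_isAnalytification_holds (totalOver (Xp q) (Pq q).A) (1 + g)
    -- the commuting transport law from the ball fibres (★ COV-5 §4), the level clause of `pieces` and `Z_equivariant`
    have htrans : ∀ v ∈ negCone (Jstar.map ι₁), ∀ v' ∈ negCone (Jstar.map ι₁), (B q).unif v = (B q).unif v' →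
        ∃ M ∈ siegelLevelGroup δ N, ∃ L : (Fin g → ℂ) ≃ₗ[ℂ] (Fin g → ℂ),
          (∀ w : Fin g ⊕ Fin g → ℝ, L (siegelPeriodMap δ (Z (gq q) v) w) = siegelPeriodMap δ (Z (gq q) v') (intAct M w)) ∧
          ∀ b, (M : Matrix (Fin g ⊕ Fin g) (Fin g ⊕ Fin g) ℤ) * (fun b => Mρ (gq q) b) b = (fun b => Mρ (gq q) b) b * M := by
      intro v hv v' hv' huv
      have hv₁ : v ∈ negCone (B q).Hℂ := by rw [(hB q).1]; exact hv
      have hv'₁ : v' ∈ negCone (B q).Hℂ := by rw [(hB q).1]; exact hv'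
      obtain ⟨γ, hγ, c, hc, hγv⟩ := (B q).exists_mem_map_mulVec_eq_smul_of_unif_eq ι₁ _ (hB q).2.1 hv₁ hv'₁ huv
      exact Z_equivariant (gq q) γ hγ v hv v' hv' c hc hγv
    obtain ⟨Yq, hYq, hread⟩ := exists_isMonHom_family_reads_of_piece hU g N δ hg hδ hN 𝓜 (piece (gq q)) (Sc _) (ιc _) (unif _)
      (unif_cont _) (unif_open _) (unif_surj _) (unif_iff _) (unif_hol _) (junction (piece (gq q))) (Xp q) (B q) (hB q).1 (ψ q)
      (Z (gq q)) (Z_hol (gq q)) (Z_mem (gq q)) (hψ q) MT φT hT MA φA hA hTot (u _) (rep _) (rep_spec _).1 (rep_spec _).2.1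
      (rep_spec _).2.2.1 (rep_spec _).2.2.2.1 (rep_spec _).2.2.2.2 (fun b => Mρ (gq q) b) (fun b v hv => Mρ_linear (gq q) v hv b) htrans
    refine ⟨Yq, hYq, fun T₀ => ?_⟩
    obtain ⟨t, rfl⟩ := hT.isHomeomorph.surjective T₀
    exact hread t
  choose Yq hYq hreadq using hpiece
  -- §4 per `(q, b)`: ★ ASM (a) — the leg `(P.A ×_X X_ℂ) ×_{X_ℂ} X_q ≅ P_q.A` over `univ.A` (★ `IsBaseChangeVia.trans` + the scheme equation `hk q`,
  -- ★ `exists_isMonHom_iso_of_isBaseChangeVia`) and the conjugate of `Yq q b` on it (★ `exists_isMonHom_conj_of_iso`)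
  have hφ : (𝓜.univ.baseChange (ε.left ≫ pullback.fst 𝓜.M.hom (bcSpec ℚ Fi))).A.IsBaseChangeVia 𝓜.univ.A (ε.left ≫ pullback.fst 𝓜.M.hom (bcSpec ℚ Fi)) (pullback.fst 𝓜.univ.A.X.hom (ε.left ≫ pullback.fst 𝓜.M.hom (bcSpec ℚ Fi))) :=
    (𝓜.univ.baseChange_isBaseChangeVia (ε.left ≫ pullback.fst 𝓜.M.hom (bcSpec ℚ Fi))).1.1
  have hlegBC : ∀ q, (((𝓜.univ.baseChange (ε.left ≫ pullback.fst 𝓜.M.hom (bcSpec ℚ Fi))).A.baseChange (pullback.fst ((Literature.AlgebraicGeometry.Motives.baseChange F Fi).obj (S.M.obj Kc)).hom (bcSpec Fi ℂ))).baseChange (hq q)).IsBaseChangeVia 𝓜.univ.A (kq q)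
      (pullback.fst ((𝓜.univ.baseChange (ε.left ≫ pullback.fst 𝓜.M.hom (bcSpec ℚ Fi))).A.baseChange (pullback.fst ((Literature.AlgebraicGeometry.Motives.baseChange F Fi).obj (S.M.obj Kc)).hom (bcSpec Fi ℂ))).X.hom (hq q) ≫ pullback.fst (𝓜.univ.baseChange (ε.left ≫ pullback.fst 𝓜.M.hom (bcSpec ℚ Fi))).A.X.hom (pullback.fst ((Literature.AlgebraicGeometry.Motives.baseChange F Fi).obj (S.M.obj Kc)).hom (bcSpec Fi ℂ)) ≫
        pullback.fst 𝓜.univ.A.X.hom (ε.left ≫ pullback.fst 𝓜.M.hom (bcSpec ℚ Fi))) := fun q => by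
    have h' := ((((𝓜.univ.baseChange (ε.left ≫ pullback.fst 𝓜.M.hom (bcSpec ℚ Fi))).A.baseChange (pullback.fst ((Literature.AlgebraicGeometry.Motives.baseChange F Fi).obj (S.M.obj Kc)).hom (bcSpec Fi ℂ))).baseChange_isBaseChangeVia (hq q)).trans
      ((𝓜.univ.baseChange (ε.left ≫ pullback.fst 𝓜.M.hom (bcSpec ℚ Fi))).A.baseChange_isBaseChangeVia (pullback.fst ((Literature.AlgebraicGeometry.Motives.baseChange F Fi).obj (S.M.obj Kc)).hom (bcSpec Fi ℂ)))).trans hφ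
    simp only [Category.assoc] at h'
    have congr_base : ∀ {T T' : Scheme.{0}} {A' : AbelianSchemeOver T'} {A₀ : AbelianSchemeOver T} {a a' : T' ⟶ T} {G : A'.X.left ⟶ A₀.X.left}, a = a' → A'.IsBaseChangeVia A₀ a G → A'.IsBaseChangeVia A₀ a' G := fun e h => e ▸ h
    exact congr_base (hk q) h'
  -- the leg isomorphisms and the conjugated endomorphisms (taken from the organs without restatement)
  choose eT heTm heT using fun q =>
    AbelianSchemeOver.exists_isMonHom_iso_of_isBaseChangeVia (𝓜.univ.A.baseChange_isBaseChangeVia (kq q)) (hlegBC q)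
  choose Y' hY'm _hY'def hconj _hY'left using fun q (b : 𝓞 F) =>
    (haveI := heTm q
     haveI := hYq q b
     AbelianSchemeOver.exists_isMonHom_conj_of_iso (eT q) (Yq q b))
  -- §5 per `b`: ★ ASM (b) — glue the leg endomorphisms over the cofan of the pieces
  choose Y hYm hYres using fun b : 𝓞 F =>
    (haveI := fun q => hY'm q b
     AbelianSchemeOver.exists_hom_of_isColimit_cofan (A := (𝓜.univ.baseChange (ε.left ≫ pullback.fst 𝓜.M.hom (bcSpec ℚ Fi))).A.baseChange (pullback.fst ((Literature.AlgebraicGeometry.Motives.baseChange F Fi).obj (S.M.obj Kc)).hom (bcSpec Fi ℂ))) (B := (𝓜.univ.baseChange (ε.left ≫ pullback.fst 𝓜.M.hom (bcSpec ℚ Fi))).A.baseChange (pullback.fst ((Literature.AlgebraicGeometry.Motives.baseChange F Fi).obj (S.M.obj Kc)).hom (bcSpec Fi ℂ)))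
      hcolL (fun q => Y' q b))
  refine ⟨Y, hYm, ?_⟩
  -- §6 at a complex point `x` of `X`: its point `x_ℂ` of `X_ℂ`, the piece `q` containing it, the point `t₀` of the piece under it
  intro x Pflat hPflat
  have hxw : x.left ≫ ((Literature.AlgebraicGeometry.Motives.baseChange F Fi).obj (S.M.obj Kc)).hom = 𝟙 _ ≫ bcSpec Fi ℂ := by rw [Category.id_comp]; exact Over.w x
  refine (⟨pullback.lift x.left (𝟙 _) hxw, pullback.lift_fst _ _ _, pullback.lift_snd _ _ _⟩ :
    ∃ xc : Spec (.of ℂ) ⟶ (pullback ((Literature.AlgebraicGeometry.Motives.baseChange F Fi).obj (S.M.obj Kc)).hom (bcSpec Fi ℂ)), xc ≫ (pullback.fst ((Literature.AlgebraicGeometry.Motives.baseChange F Fi).obj (S.M.obj Kc)).hom (bcSpec Fi ℂ)) = x.left ∧ xc ≫ pullback.snd ((Literature.AlgebraicGeometry.Motives.baseChange F Fi).obj (S.M.obj Kc)).hom (bcSpec Fi ℂ) = 𝟙 _).elim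
    fun xc hxc' => ?_
  refine (Literature.AlgebraicGeometry.Morphisms.exists_eq_of_isColimit_cofan hcolL (xc.base (IsLocalRing.closedPoint ℂ))).elim
    fun q hq' => hq'.elim fun y hy => ?_
  refine (⟨IsOpenImmersion.lift (hq q) xc (range_subset_range_of_eq xc (hq q) y _ hy), IsOpenImmersion.lift_fac _ _ _⟩ :
    ∃ t₀ : Spec (.of ℂ) ⟶ (Xp q).left, t₀ ≫ hq q = xc).elim fun t₀ ht₀ => ?_
  have hXpq : hq q ≫ pullback.snd ((Literature.AlgebraicGeometry.Motives.baseChange F Fi).obj (S.M.obj Kc)).hom (bcSpec Fi ℂ) = (Xp q).hom := Over.w (leg q ≫ e.inv)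
  refine (⟨Over.homMk t₀ (by
      change t₀ ≫ (Xp q).hom = (specOver ℂ ℂ).hom
      rw [← hXpq, ← Category.assoc, ht₀, hxc'.2]
      exact specOver_complex_hom.symm), rfl⟩ : ∃ T₀ : ComplexPoints (Xp q), T₀.left = t₀).elim fun T₀ hT₀ => ?_
  refine (hreadq q T₀).elim fun v hv3 => ?_
  have hunif := hv3.2.1
  have hx₀ : t₀ ≫ hq q ≫ (pullback.fst ((Literature.AlgebraicGeometry.Motives.baseChange F Fi).obj (S.M.obj Kc)).hom (bcSpec Fi ℂ)) = x.left := by rw [← Category.assoc, ht₀, hxc'.1]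
  refine ⟨v, hv3.1, gq q, ?_, ?_⟩
  · -- the flat shadow `pts x♭ = [v, g_q Kc]` (★ T1′)
    refine pts_eq_mk_of_piece_point S Kc (algebraMap Fi ℂ) e he₂ (Xp q) (B q) (leg q) (gq q) (hB q).2.2 v hv3.1 x Pflat hPflat ?_
    rw [hunif, hT₀]
    exact hx₀.symm
  · intro u' r' hu huc hr hmult hrmat
    refine (hv3.2.2 u' r' hu huc hr hmult hrmat).elim fun hZv h1 => h1.elim fun m h2 => h2.elim fun Θ h3 => h3.elim fun Λ hP => ?_
    have hγ := hP.2.2.2.1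
    have hΨ := hP.2.2.2.2.1
    have hread := hP.2.2.2.2.2
    -- ★ RD-T3: the (ADM)-package moves from `P_q` at `t₀` to `P` at `x` through the fibre of the universal family
    have hp : x.left ≫ (ε.left ≫ pullback.fst 𝓜.M.hom (bcSpec ℚ Fi)) = T₀.left ≫ kq q := by
      rw [hT₀]
      have e1 : x.left ≫ (ε.left ≫ pullback.fst 𝓜.M.hom (bcSpec ℚ Fi)) = (t₀ ≫ hq q ≫ (pullback.fst ((Literature.AlgebraicGeometry.Motives.baseChange F Fi).obj (S.M.obj Kc)).hom (bcSpec Fi ℂ))) ≫ (ε.left ≫ pullback.fst 𝓜.M.hom (bcSpec ℚ Fi)) := by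
        rw [← hx₀]
        rfl
      exact e1.trans ((Category.assoc _ _ _).trans (congrArg (t₀ ≫ ·) ((Category.assoc _ _ _).trans (hk q))))
    refine (SiegelAdelicMarking.exists_admPackage_along_isBaseChangeVia₂ (hZ := hZv) (𝓜.univ.baseChange_isBaseChangeVia (kq q))
        (𝓜.univ.baseChange_isBaseChangeVia (ε.left ≫ pullback.fst 𝓜.M.hom (bcSpec ℚ Fi))) hp hδ m Θ Λ hP.1 hP.2.1 hP.2.2.1).elim fun e₁ h4 => h4.elim fun e₂ h5 => ?_
    have he₁ := h5.1
    have he₂' := h5.2.1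
    refine h5.2.2.elim fun m₂ h6 => h6.elim fun Θ₂ h7 => h7.elim fun Λ₂ hQ => ?_
    have htoFun := hQ.2.2.2.2.2
    refine ⟨m₂, Θ₂, Λ₂, hQ.1, hQ.2.1, hQ.2.2.1, hQ.2.2.2.1.trans hγ, fun w => by rw [hQ.2.2.2.2.1]; exact hΨ w, ?_⟩
    intro b τ qpt hq₁ hq₂
    haveI := hYm b
    haveI := hYq q b
    haveI := heTm q
    have hY' : (Over.pullback (hq q)).map (Y b) ≫ (eT q).hom = (eT q).hom ≫ Yq q b :=
      (congrArg (fun z => z ≫ (eT q).hom) (hYres b q)).trans (hconj q b)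
    -- ★ RD-X through §0 `reading_transport_at_point` (instantiated by unification with the goal's own terms)
    exact reading_transport_at_point 𝓜.univ.A _ (𝓜.univ.A.baseChange (kq q)) _ (pullback.fst 𝓜.univ.A.X.hom (kq q)) _ _ (hq q)
      (eT q) (hmT := heTm q) (heT q) (Y b) (hmY := hYm b) (Yq q b) (hmY₁ := hYq q b) hY' xc (𝟙 _) hxc'.1 hxc'.2
      ((congrArg (· ≫ hq q) hT₀).trans ht₀) e₁ (fibrePointToLeft_map_eq_of_toSchemeHom_comp _ _ _ e₁ he₁) e₂
      (fibrePointToLeft_map_eq_of_toSchemeHom_comp _ _ _ e₂ he₂') (hread b τ) (htoFun τ) (htoFun _) qpt hq₁ hq₂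

end Summit.HodgeConjecture.HodgeConjecture.Theorems.F0P6aReadsCReadingOfJunction

end
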